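import Summits.QuantumFields.YangMills.Theorems.BalabanUVNodesN19UniformMomentSummabilityThreshold
import Summits.QuantumFields.YangMills.Theorems.BalabanUVNodesN19LawSummabilityThresholdSharp

/-!
# YM-DAG node N19 (= NE7 proper) — THE WINDOW AND THE UNIFORM-MOMENT CURRENCIES SEPARATE ALONG THE TOWER
# (one remainder `ε_K = e^{−(K+1)log²(K+1)}`: uniform moment matching forces summable law increments, window matching does not)

Cell `pub-ymgap`, HUMAN RULING D-0062 (Track A) ∕ D-0149 (work-bound push), R141 (C) wider-strategy seat `pub-ymgap-dag-n19-e` (strategy s3 =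
ALTERNATIVE CURRENCY), generation g23, module 3 (lineage module 80).  Route `Summits/QuantumFields/YangMills/Theses/BalabanUVNodes.lean` rev 25,
cluster item K3⁷ «SpineGivenEndpointR13SepCoPH» (stmt-QuantumFields-20544); filed `--supports` that item `--as helper` (it proves no registered
stub).  COUNT-NEUTRAL: [folklore] over Mathlib (Cauchy condensation `summable_condensed_iff_of_nonneg`, `Real.posLog`) + the lineage BY NAME — module
78 `…N19UniformMomentSummabilityThreshold` (`summable_lawIncrements_of_uniformMoments`), module 75 `…N19LawSummabilityThresholdSharp`
(`exists_target_not_summable_lawIncrements`), module 74 (`logRate_antitone`, `logRate_pos`); TOY laws; `Spine.NE7.Target` (N19's DECL-target SHAPE)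
is CONCLUDED for an explicit toy family (module 75's), never for a scheme object; no Theses import; NOT a discharge claim.

THE POINT.  Module 75 (g22): for antitone window remainders the law-summability threshold of N19's window currency is `Σ_K log(e+L_K)∕(1+L_K) < ∞`;
modules 78∕79 (g23): for antitone closeness the threshold of the uniform-moment currency (ALL moments, the currency of UNIFORM `Target`) is
`Σ_K 1∕(1+L_K) < ∞` (`L_K = log⁺` of the inverse remainder).  Both fail for every geometric remainder and both hold at `e^{−(K+1)²}` (modules 76 ∕ 79),
so THIS FILE exhibits a remainder where they DIFFER: `ε_K = e^{−L_K}`, `L_K = (K+1)·log²(K+1)`.  §1: `L` is non-negative and non-decreasing, so `ε` is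
positive, antitone, `≤ 1`, summable (`ε_K ≤ (e^{−log²2})^K`), and `log⁺ ε_K⁻¹ = L_K`.  §2 by CAUCHY CONDENSATION: ★ `summable_invLogRate_sepScale` —
`Σ 1∕(1+L_K) < ∞` (condensed term `2^k∕(1+L_{2^k}) ≤ 1∕(k² log²2)`); ★ `not_summable_logRate_sepScale` — `Σ log(e+L_K)∕(1+L_K) = ∞` (condensed term
`≥ k∕(4(k+1)² log 2) ≥ 1∕(8(k+1) log 2)` for `k ≥ 2`: harmonic).  §3 ★★ `uniformMoments_summable_but_window_not`: at this ONE remainder sequence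
(i) EVERY sequence of probability laws on `[−1,1]` whose moments move by at most `ε_K` UNIFORMLY IN THE ORDER has summable bounded-Lipschitz
increments along every continuous, uniformly Lipschitz ∕ bounded test sequence (module 78), while (ii) for every window `l₀ > 0` there ARE probability
laws on `[−1,1]` satisfying N19's DECL-target shape `Spine.NE7.Target 1 l₀ ε (K t ↦ mgf λ_K t)` (window matching modulo constants, remainder `ε`, AND
`Σε < ∞`) with continuous `1`-Lipschitz `1`-bounded tests of NON-summable increments (module 75).  So along the tower the uniform-moment currency is
STRICTLY stronger than the window currency at the level of summable law increments — the window's intrinsic `log log` (p555512 ∕ p553677, two-sided per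
step) integrates to a genuine gap; neither N19's `Target` nor its uniform version is thereby proved or disproved for anything of Bałaban's.

HONEST FRAMING (binding).  Elementary and [folklore]; TOY laws; NO consumer in the DAG today (a structural statement about the seat's own currencies);
nothing of Bałaban's instantiated; NE7 NOT PRINTED, NOT proved; N19 NOT discharged; count-neutral.  One finite `T⁴` programme at fixed `ε`; nothing
continuum ∕ `ℝ⁴` ∕ OS ∕ mass-gap ∕ Clay.  0 `def` ∕ 0 `sorry`.
-/

noncomputable section

open Real MeasureTheory ProbabilityTheory

namespace Summit.QuantumFields.YangMills.Theorems.BalabanUVNodesN19SummabilityThresholdsSeparate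

open Literature.MathematicalPhysics.QuantumFieldTheory.Balaban1983to89
open T4CauchySum (MatchingModConstants)
open Summit.QuantumFields.BalabanUV.T4Continuum.Spine
open Summit.QuantumFields.YangMills.Theorems.BalabanUVNodesN19UniformMomentSummabilityThreshold (summable_lawIncrements_of_uniformMoments)
open Summit.QuantumFields.YangMills.Theorems.BalabanUVNodesN19LawSummabilityThreshold (logRate_antitone logRate_pos)
open Summit.QuantumFields.YangMills.Theorems.BalabanUVNodesN19LawSummabilityThresholdSharp (exists_target_not_summable_lawIncrements)

/-! ## §1 The separating scale `L_K = (K+1)·log²(K+1)` and the remainder `ε_K = e^{−L_K}` [folklore] -/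

/-- `L_K ≥ 0`. [folklore] -/
theorem sepScale_nonneg (K : ℕ) : 0 ≤ ((K : ℝ) + 1) * Real.log ((K : ℝ) + 1) ^ 2 := by positivity

/-- `L` is non-decreasing. [folklore] -/
theorem sepScale_mono {K K' : ℕ} (h : K ≤ K') :
    ((K : ℝ) + 1) * Real.log ((K : ℝ) + 1) ^ 2 ≤ ((K' : ℝ) + 1) * Real.log ((K' : ℝ) + 1) ^ 2 := by
  have hK : (K : ℝ) ≤ K' := by exact_mod_cast h
  have hl0 : 0 ≤ Real.log ((K : ℝ) + 1) := Real.log_nonneg (by linarith [(Nat.cast_nonneg K : (0 : ℝ) ≤ K)])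
  have hl : Real.log ((K : ℝ) + 1) ≤ Real.log ((K' : ℝ) + 1) := Real.log_le_log (by positivity) (by linarith)
  exact mul_le_mul (by linarith) (pow_le_pow_left₀ hl0 hl 2) (by positivity) (by positivity)

/-- `log⁺ (e^{−L})⁻¹ = L` for `L ≥ 0`. [folklore] -/
theorem posLog_inv_exp_neg {L : ℝ} (hL : 0 ≤ L) : Real.posLog (Real.exp (-L))⁻¹ = L := by
  rw [← Real.exp_neg, neg_neg, Real.posLog_eq_log (by rw [abs_of_pos (Real.exp_pos _)]; exact Real.one_le_exp hL), Real.log_exp]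

/-- `ε` is positive. [folklore] -/
theorem sepRemainder_pos (K : ℕ) : 0 < Real.exp (-(((K : ℝ) + 1) * Real.log ((K : ℝ) + 1) ^ 2)) := Real.exp_pos _

/-- `ε` is antitone. [folklore] -/
theorem sepRemainder_antitone : Antitone fun K : ℕ => Real.exp (-(((K : ℝ) + 1) * Real.log ((K : ℝ) + 1) ^ 2)) :=
  fun _ _ h => Real.exp_le_exp.2 (neg_le_neg (sepScale_mono h))

/-- `ε` is summable (`ε_K ≤ (e^{−log²2})^K`, a geometric sequence of ratio `< 1`). [folklore] -/
theorem summable_sepRemainder : Summable fun K : ℕ => Real.exp (-(((K : ℝ) + 1) * Real.log ((K : ℝ) + 1) ^ 2)) := by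
  set q : ℝ := Real.exp (-(Real.log 2 ^ 2)) with hq
  have hq0 : 0 ≤ q := (Real.exp_pos _).le
  have hq1 : q < 1 := Real.exp_lt_one_iff.2 (by have := Real.log_two_gt_d9; nlinarith)
  refine Summable.of_nonneg_of_le (fun K => (Real.exp_pos _).le) (fun K => ?_) (summable_geometric_of_lt_one hq0 hq1)
  rw [hq, ← Real.exp_nat_mul, Real.exp_le_exp]
  -- `K·log²2 ≤ (K+1)·log²(K+1)` (trivial at `K = 0`; `log 2 ≤ log(K+1)` for `K ≥ 1`)
  rcases Nat.eq_zero_or_pos K with hK | hK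
  · subst hK; norm_num
  · have hK1 : (1 : ℝ) ≤ K := by exact_mod_cast hK
    have hl2 : 0 ≤ Real.log 2 := Real.log_nonneg one_le_two
    have hl : Real.log 2 ≤ Real.log ((K : ℝ) + 1) := Real.log_le_log two_pos (by linarith)
    have hp : Real.log 2 ^ 2 ≤ Real.log ((K : ℝ) + 1) ^ 2 := pow_le_pow_left₀ hl2 hl 2
    nlinarith [sq_nonneg (Real.log 2), mul_le_mul_of_nonneg_left hp (by linarith : (0 : ℝ) ≤ (K : ℝ) + 1)]

/-! ## §2 Cauchy condensation: `Σ 1∕(1+L_K) < ∞` but `Σ log(e+L_K)∕(1+L_K) = ∞` [folklore] -/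

/-- The scale at the dyadic points from below: `2^k·k²·log²2 ≤ L_{2^k}`. [folklore] -/
theorem sepScale_two_pow_ge (k : ℕ) :
    (2 : ℝ) ^ k * ((k : ℝ) ^ 2 * Real.log 2 ^ 2) ≤ (((2 ^ k : ℕ) : ℝ) + 1) * Real.log (((2 ^ k : ℕ) : ℝ) + 1) ^ 2 := by
  push_cast
  have h2k : (0 : ℝ) < (2 : ℝ) ^ k := by positivity
  have hl : (k : ℝ) * Real.log 2 ≤ Real.log ((2 : ℝ) ^ k + 1) := by
    rw [← Real.log_pow]
    exact Real.log_le_log h2k (by linarith)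
  have hl0 : 0 ≤ (k : ℝ) * Real.log 2 := mul_nonneg (Nat.cast_nonneg k) (Real.log_nonneg one_le_two)
  have hp : ((k : ℝ) * Real.log 2) ^ 2 ≤ Real.log ((2 : ℝ) ^ k + 1) ^ 2 := pow_le_pow_left₀ hl0 hl 2
  nlinarith [mul_le_mul_of_nonneg_left hp h2k.le, sq_nonneg (Real.log ((2 : ℝ) ^ k + 1))]

/-- The scale at the dyadic points from above: `L_{2^k} ≤ 2^{k+1}·(k+1)²·log²2`. [folklore] -/
theorem sepScale_two_pow_le (k : ℕ) :
    (((2 ^ k : ℕ) : ℝ) + 1) * Real.log (((2 ^ k : ℕ) : ℝ) + 1) ^ 2 ≤ (2 : ℝ) ^ (k + 1) * (((k : ℝ) + 1) ^ 2 * Real.log 2 ^ 2) := by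
  push_cast
  have h2k : (1 : ℝ) ≤ (2 : ℝ) ^ k := one_le_pow₀ one_le_two
  have hup : (2 : ℝ) ^ k + 1 ≤ (2 : ℝ) ^ (k + 1) := by rw [pow_succ]; linarith
  have hl0 : 0 ≤ Real.log ((2 : ℝ) ^ k + 1) := Real.log_nonneg (by linarith)
  have hl : Real.log ((2 : ℝ) ^ k + 1) ≤ ((k : ℝ) + 1) * Real.log 2 := by
    calc Real.log ((2 : ℝ) ^ k + 1) ≤ Real.log ((2 : ℝ) ^ (k + 1)) := Real.log_le_log (by positivity) hup
      _ = ((k : ℝ) + 1) * Real.log 2 := by rw [Real.log_pow]; push_cast; ring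
  have hp : Real.log ((2 : ℝ) ^ k + 1) ^ 2 ≤ (((k : ℝ) + 1) * Real.log 2) ^ 2 := pow_le_pow_left₀ hl0 hl 2
  calc ((2 : ℝ) ^ k + 1) * Real.log ((2 : ℝ) ^ k + 1) ^ 2 ≤ (2 : ℝ) ^ (k + 1) * (((k : ℝ) + 1) * Real.log 2) ^ 2 :=
        mul_le_mul hup hp (by positivity) (by positivity)
    _ = (2 : ℝ) ^ (k + 1) * (((k : ℝ) + 1) ^ 2 * Real.log 2 ^ 2) := by ring

/-- ★ **THE UNIFORM-MOMENT THRESHOLD IS MET**: `Σ_K 1∕(1 + log⁺ ε_K⁻¹) = Σ_K 1∕(1 + L_K) < ∞` (Cauchy condensation; condensed term `≤ 1∕(k² log²2)`).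
[folklore] -/
theorem summable_invLogRate_sepScale :
    Summable fun K : ℕ => 1 / (1 + Real.posLog (Real.exp (-(((K : ℝ) + 1) * Real.log ((K : ℝ) + 1) ^ 2)))⁻¹) := by
  simp_rw [posLog_inv_exp_neg (sepScale_nonneg _)]
  have h0 : ∀ K : ℕ, 0 ≤ 1 / (1 + ((K : ℝ) + 1) * Real.log ((K : ℝ) + 1) ^ 2) := fun K => by
    have := sepScale_nonneg K; positivity
  have hmono : ∀ ⦃m n : ℕ⦄, 0 < m → m ≤ n →
      1 / (1 + ((n : ℝ) + 1) * Real.log ((n : ℝ) + 1) ^ 2) ≤ 1 / (1 + ((m : ℝ) + 1) * Real.log ((m : ℝ) + 1) ^ 2) :=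
    fun m n _ hmn => one_div_le_one_div_of_le (by have := sepScale_nonneg m; positivity) (by linarith [sepScale_mono hmn])
  refine (summable_condensed_iff_of_nonneg h0 hmono).1 ((summable_nat_add_iff 1).1 ?_)
  -- the condensed series from `k = 1` on: `2^{k+1}∕(1 + L_{2^{k+1}}) ≤ (1∕log²2)·1∕(k+1)²`
  have hl2 : 0 < Real.log 2 := Real.log_pos one_lt_two
  refine Summable.of_nonneg_of_le (fun k => mul_nonneg (by positivity) (h0 _)) (fun k => ?_)
    (((summable_nat_add_iff 1).2 ((Real.summable_one_div_nat_pow (p := 2)).2 one_lt_two)).mul_left (1 / Real.log 2 ^ 2))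
  have hL := sepScale_two_pow_ge (k + 1)
  have hk : (0 : ℝ) < ((k + 1 : ℕ) : ℝ) := by positivity
  have h2k : (0 : ℝ) < (2 : ℝ) ^ (k + 1) := by positivity
  rw [show (2 : ℝ) ^ (k + 1) * (1 / (1 + (((2 ^ (k + 1) : ℕ) : ℝ) + 1) * Real.log (((2 ^ (k + 1) : ℕ) : ℝ) + 1) ^ 2)) =
      (2 : ℝ) ^ (k + 1) / (1 + (((2 ^ (k + 1) : ℕ) : ℝ) + 1) * Real.log (((2 ^ (k + 1) : ℕ) : ℝ) + 1) ^ 2) by ring,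
    show 1 / Real.log 2 ^ 2 * (1 / ((k + 1 : ℕ) : ℝ) ^ 2) = (2 : ℝ) ^ (k + 1) / ((2 : ℝ) ^ (k + 1) * (((k + 1 : ℕ) : ℝ) ^ 2 * Real.log 2 ^ 2)) by
      field_simp]
  exact div_le_div_of_nonneg_left h2k.le (by positivity) (by push_cast at hL ⊢; linarith)

/-- ★ **THE WINDOW THRESHOLD FAILS**: `Σ_K log(e + log⁺ ε_K⁻¹)∕(1 + log⁺ ε_K⁻¹) = Σ_K log(e+L_K)∕(1+L_K) = ∞` (Cauchy condensation: the condensed term is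
`≥ 2^k·k log 2∕(2^{k+2}(k+1)² log²2) ≥ 1∕(8(k+1) log 2)` for `k ≥ 2` — harmonic). [folklore] -/
theorem not_summable_logRate_sepScale :
    ¬ Summable fun K : ℕ => Real.log (Real.exp 1 + Real.posLog (Real.exp (-(((K : ℝ) + 1) * Real.log ((K : ℝ) + 1) ^ 2)))⁻¹) /
      (1 + Real.posLog (Real.exp (-(((K : ℝ) + 1) * Real.log ((K : ℝ) + 1) ^ 2)))⁻¹) := by
  simp_rw [posLog_inv_exp_neg (sepScale_nonneg _)]
  intro hsum
  have h0 : ∀ K : ℕ, 0 ≤ Real.log (Real.exp 1 + ((K : ℝ) + 1) * Real.log ((K : ℝ) + 1) ^ 2) /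
      (1 + ((K : ℝ) + 1) * Real.log ((K : ℝ) + 1) ^ 2) := fun K => (logRate_pos (sepScale_nonneg K)).le
  have hmono : ∀ ⦃m n : ℕ⦄, 0 < m → m ≤ n →
      Real.log (Real.exp 1 + ((n : ℝ) + 1) * Real.log ((n : ℝ) + 1) ^ 2) / (1 + ((n : ℝ) + 1) * Real.log ((n : ℝ) + 1) ^ 2) ≤
        Real.log (Real.exp 1 + ((m : ℝ) + 1) * Real.log ((m : ℝ) + 1) ^ 2) / (1 + ((m : ℝ) + 1) * Real.log ((m : ℝ) + 1) ^ 2) :=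
    fun m n _ hmn => logRate_antitone (sepScale_nonneg m) (sepScale_mono hmn)
  have hc := (summable_nat_add_iff 2).2 ((summable_condensed_iff_of_nonneg h0 hmono).2 hsum)
  -- the condensed series from `k = 2` on dominates `(1∕(8 log 2))·1∕(k+3)`
  have hl2 := Real.log_two_gt_d9
  have hl2' := Real.log_two_lt_d9
  have hlow : ∀ k : ℕ, 1 / (8 * Real.log 2) * (1 / ((k + 3 : ℕ) : ℝ)) ≤
      (2 : ℝ) ^ (k + 2) * (Real.log (Real.exp 1 + (((2 ^ (k + 2) : ℕ) : ℝ) + 1) * Real.log (((2 ^ (k + 2) : ℕ) : ℝ) + 1) ^ 2) /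
        (1 + (((2 ^ (k + 2) : ℕ) : ℝ) + 1) * Real.log (((2 ^ (k + 2) : ℕ) : ℝ) + 1) ^ 2)) := by
    intro k
    set L : ℝ := (((2 ^ (k + 2) : ℕ) : ℝ) + 1) * Real.log (((2 ^ (k + 2) : ℕ) : ℝ) + 1) ^ 2 with hLdef
    have hLge := sepScale_two_pow_ge (k + 2)
    have hLle := sepScale_two_pow_le (k + 2)
    rw [← hLdef] at hLge hLle
    push_cast at hLge hLle
    have h2k : (4 : ℝ) ≤ (2 : ℝ) ^ (k + 2) := by
      rw [pow_add]; nlinarith [one_le_pow₀ (one_le_two : (1 : ℝ) ≤ 2) (n := k)]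
    have h2k0 : (0 : ℝ) < (2 : ℝ) ^ (k + 2) := by positivity
    have hk2 : (2 : ℝ) ≤ (k : ℝ) + 2 := by linarith [(Nat.cast_nonneg k : (0 : ℝ) ≤ k)]
    -- `2^{k+2} ≤ L` (since `(k+2)² log²2 ≥ 4·0.48 ≥ 1`), hence `log(e + L) ≥ (k+2) log 2`
    have hl2sq : (0.48 : ℝ) ≤ Real.log 2 ^ 2 := by nlinarith [mul_le_mul hl2.le hl2.le (by norm_num) (by linarith)]
    have hk2sq : (4 : ℝ) ≤ ((k : ℝ) + 2) ^ 2 := by nlinarith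
    have hsq : (1 : ℝ) ≤ ((k : ℝ) + 2) ^ 2 * Real.log 2 ^ 2 := by
      nlinarith [mul_le_mul hk2sq hl2sq (by norm_num) (by positivity)]
    have hL1 : (2 : ℝ) ^ (k + 2) ≤ L := by nlinarith
    have hlogL : ((k : ℝ) + 2) * Real.log 2 ≤ Real.log (Real.exp 1 + L) := by
      calc ((k : ℝ) + 2) * Real.log 2 = Real.log ((2 : ℝ) ^ (k + 2)) := by rw [Real.log_pow]; push_cast; ring
        _ ≤ Real.log (Real.exp 1 + L) := Real.log_le_log h2k0 (by linarith [Real.exp_pos 1])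
    -- `1 + L ≤ 2^{k+2}·4(k+3)² log²2`
    have hLle' : L ≤ 2 * (2 : ℝ) ^ (k + 2) * (((k : ℝ) + 3) ^ 2 * Real.log 2 ^ 2) := by
      have e1 : (2 : ℝ) ^ (k + 2 + 1) = 2 * 2 ^ (k + 2) := by rw [pow_succ]; ring
      have e2 : ((k : ℝ) + 2 + 1) = (k : ℝ) + 3 := by ring
      rw [e1, e2] at hLle
      linarith
    have hsq3 : (1 : ℝ) ≤ ((k : ℝ) + 3) ^ 2 * Real.log 2 ^ 2 := by nlinarith
    have hX : (1 : ℝ) ≤ (2 : ℝ) ^ (k + 2) * (((k : ℝ) + 3) ^ 2 * Real.log 2 ^ 2) :=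
      one_le_mul_of_one_le_of_one_le (by linarith) hsq3
    have hden : 1 + L ≤ (2 : ℝ) ^ (k + 2) * (4 * ((k : ℝ) + 3) ^ 2 * Real.log 2 ^ 2) := by nlinarith
    have hden0 : 0 < 1 + L := by linarith
    -- assemble: `(1∕(8 log 2))·1∕(k+3) ≤ (k+2)∕(4(k+3)² log 2) ≤ 2^{k+2} log(e+L)∕(1+L)`
    have hk3 : ((k + 3 : ℕ) : ℝ) = (k : ℝ) + 3 := by push_cast; ring
    rw [hk3]
    have hlog0 : 0 ≤ Real.log (Real.exp 1 + L) := Real.log_nonneg (by linarith [Real.add_one_le_exp (1 : ℝ)])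
    have h1 : ((k : ℝ) + 2) * Real.log 2 / ((2 : ℝ) ^ (k + 2) * (4 * ((k : ℝ) + 3) ^ 2 * Real.log 2 ^ 2)) ≤
        Real.log (Real.exp 1 + L) / (1 + L) := div_le_div₀ hlog0 hlogL hden0 hden
    have hRHS : ((k : ℝ) + 2) / (4 * ((k : ℝ) + 3) ^ 2 * Real.log 2) ≤ (2 : ℝ) ^ (k + 2) * (Real.log (Real.exp 1 + L) / (1 + L)) := by
      have e : ((k : ℝ) + 2) / (4 * ((k : ℝ) + 3) ^ 2 * Real.log 2) =
          (2 : ℝ) ^ (k + 2) * (((k : ℝ) + 2) * Real.log 2 / ((2 : ℝ) ^ (k + 2) * (4 * ((k : ℝ) + 3) ^ 2 * Real.log 2 ^ 2))) := by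
        field_simp
      rw [e]
      exact mul_le_mul_of_nonneg_left h1 h2k0.le
    have key : 1 / (8 * Real.log 2) * (1 / ((k : ℝ) + 3)) ≤ ((k : ℝ) + 2) / (4 * ((k : ℝ) + 3) ^ 2 * Real.log 2) := by
      rw [div_mul_div_comm, one_mul, div_le_div_iff₀ (by positivity) (by positivity)]
      have h := mul_nonneg (by linarith : (0 : ℝ) ≤ 2 * ((k : ℝ) + 2) - ((k : ℝ) + 3))
        (by positivity : (0 : ℝ) ≤ 4 * ((k : ℝ) + 3) * Real.log 2)
      nlinarith [h]
    exact key.trans hRHS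
  have hh : Summable fun k : ℕ => 1 / (8 * Real.log 2) * (1 / ((k + 3 : ℕ) : ℝ)) :=
    Summable.of_nonneg_of_le (fun k => by positivity) hlow hc
  have hh' : Summable fun k : ℕ => (1 : ℝ) / ((k + 3 : ℕ) : ℝ) := by
    refine (hh.mul_left (8 * Real.log 2)).congr fun k => ?_
    field_simp
  exact Real.not_summable_one_div_natCast ((summable_nat_add_iff 3).1 hh')

/-! ## §3 The separation [folklore] -/

/-- ★★ **THE TWO CURRENCIES SEPARATE ALONG THE TOWER.**  At the remainder `ε_K = e^{−(K+1)log²(K+1)}`: (i) EVERY sequence of probability laws `λ_K` on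
`[−1,1]` with `|∫x^j dλ_{K+1} − ∫x^j dλ_K| ≤ ε_K` for every `j` (uniform moment matching) has summable increments `|∫g_K dλ_{K+1} − ∫g_K dλ_K|` along every
sequence of continuous tests, uniformly `K_g`-Lipschitz (`0 ≤ K_g`) and `G`-bounded on `[−1,1]` (module 78 + §2); (ii) for every window `l₀ > 0` there
are probability laws `λ_K` on `[−1,1]` with `Spine.NE7.Target 1 l₀ ε (K t ↦ mgf λ_K t)` — N19's DECL-target SHAPE at volume factor `1`: window
matching modulo constants with remainder `ε` AND `Σε < ∞` — and continuous `1`-Lipschitz `1`-bounded tests with NON-summable increments (module 75 +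
§2).  TOY laws; nothing of Bałaban's. [folklore] -/
theorem uniformMoments_summable_but_window_not :
    (∀ (Λ : ℕ → Measure ℝ), (∀ K, IsProbabilityMeasure (Λ K)) → (∀ K, Λ K (Set.Icc (-1 : ℝ) 1)ᶜ = 0) →
      (∀ K j : ℕ, |∫ x, x ^ j ∂Λ (K + 1) - ∫ x, x ^ j ∂Λ K| ≤ Real.exp (-(((K : ℝ) + 1) * Real.log ((K : ℝ) + 1) ^ 2))) →
      ∀ (g : ℕ → ℝ → ℝ), (∀ K, Continuous (g K)) → ∀ (Kg G : ℝ), 0 ≤ Kg →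
        (∀ (K : ℕ) (x y : ℝ), x ∈ Set.Icc (-1 : ℝ) 1 → y ∈ Set.Icc (-1 : ℝ) 1 → |g K x - g K y| ≤ Kg * |x - y|) →
        (∀ (K : ℕ) (x : ℝ), x ∈ Set.Icc (-1 : ℝ) 1 → |g K x| ≤ G) →
        Summable fun K => |∫ x, g K x ∂Λ (K + 1) - ∫ x, g K x ∂Λ K|) ∧
    (∀ l₀ : ℝ, 0 < l₀ →
      ∃ Λ : ℕ → Measure ℝ, (∀ K, IsProbabilityMeasure (Λ K)) ∧ (∀ K, Λ K (Set.Icc (-1 : ℝ) 1)ᶜ = 0) ∧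
        NE7.Target 1 l₀ (fun K : ℕ => Real.exp (-(((K : ℝ) + 1) * Real.log ((K : ℝ) + 1) ^ 2))) (fun K t => mgf id (Λ K) t) ∧
        ∃ g : ℕ → ℝ → ℝ, (∀ K, Continuous (g K)) ∧
          (∀ (K : ℕ) (x y : ℝ), x ∈ Set.Icc (-1 : ℝ) 1 → y ∈ Set.Icc (-1 : ℝ) 1 → |g K x - g K y| ≤ 1 * |x - y|) ∧
          (∀ (K : ℕ) (x : ℝ), x ∈ Set.Icc (-1 : ℝ) 1 → |g K x| ≤ 1) ∧
          ¬ Summable (fun K => |∫ x, g K x ∂Λ (K + 1) - ∫ x, g K x ∂Λ K|)) := by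
  refine ⟨fun Λ hP hc hM g hg Kg G hK0 hL hB => ?_, fun l₀ hl₀ => ?_⟩
  · haveI := hP
    exact summable_lawIncrements_of_uniformMoments hc hM summable_invLogRate_sepScale hg hK0 hL hB
  · have hS : ¬ Summable fun K : ℕ =>
        Real.log (Real.exp 1 + Real.posLog (1 * Real.exp (-(((K : ℝ) + 1) * Real.log ((K : ℝ) + 1) ^ 2)))⁻¹) /
          (1 + Real.posLog (1 * Real.exp (-(((K : ℝ) + 1) * Real.log ((K : ℝ) + 1) ^ 2)))⁻¹) := by
      simp_rw [one_mul]
      exact not_summable_logRate_sepScale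
    exact exists_target_not_summable_lawIncrements hl₀ one_pos sepRemainder_pos sepRemainder_antitone summable_sepRemainder hS

end Summit.QuantumFields.YangMills.Theorems.BalabanUVNodesN19SummabilityThresholdsSeparate

end
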